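import Mathlib
import Summits.ValiantsHypothesis.ValiantsHypothesis.Theorems.FifoMatchingNFPolytopeQueueGridPPHardOfCorGridMinor
import Summits.ValiantsHypothesis.ValiantsHypothesis.Theorems.FifoMatchingNFPolytopeQueueGridFaceProjection
import Literature.Combinatorics.Optimization.CorrelationPolytopeGridMinor
import Literature.Barriers.PneNP.ExtendedFormulationLinearImage
import Literature.Barriers.PneNP.TSPExtensionComplexityFaces
import Literature.Barriers.PneNP.CorrelationPolytopeXCLowerBoundGraph
import HarnessLib

/-!
# K1 discharge end: the grid-only COR bound `hB` from the G♭ construction statement `GridCorCliqueFace`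

Helper (c1 g5; director-valiant R170 (b)(2) / R172 (b)(2) / R173 (a)) for stmt-ValiantsHypothesis-26254
(`Theses.FifoMatching.NFPolytopeQuasiPolyXC`, K1).  G♭ = FORM A (crit-3 (β) nod, tenure l.1217, filed as the FifoMatching r9
support item `GridCorCliqueFace`): for all large `t` some face of `COR(G_{t,t})` cut out by valid equalities maps LINEARLY onto
`COR(K_h)` with `h ≥ c·t`.  This file (ROUTE-INDEPENDENT: no `Theses` import anywhere below it, per the
theses-cone lint) proves, with FORM A's body as an explicit hypothesis — so the day `…Theses.FifoMatching.GridCorCliqueFace_holds`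
exists the UNCONDITIONAL K1 closer is the 3-liner, in a leaf file importing the route file and this one only,
`theorem … : …Theses.FifoMatching.NFPolytopeQuasiPolyXC := newtXC_of_gridCorCliqueFace GridCorCliqueFace_holds`
(`--workitem stmt-ValiantsHypothesis-26254`; the route decl inlines `newt`/`NN_n` verbatim, checked by `exact` in p618136):

* `corGridBound_of_gridCorCliqueFace` — FORM A ⇒ `hB : ∃ c > 0, ∃ t₀, ∀ t ≥ t₀, ∀ R, HasEFOfSize (COR(G_{t,t})) R → 2^{c t} ≤ R`
  by `HasEFOfSize.inter_eqs` (the face; size kept), `HasEFOfSize.image_linearMap` (p613760; the projection; size kept),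
  val-lit-p10 g2's `corPolytopeGraph_top_two_pow_half_le` (Kaibel–Weltge `xc(COR(K_h)) ≥ 1.5^h` in the graph encoding, base-2
  form `2^{h/2} ≤ R` for `h ≥ 4`) and `2^{(c/2) t} ≤ 2^{h/2}`; the constant halves and `t₀` grows to `max t₀ ⌈4/c⌉`;
* `newtXC_of_gridCorCliqueFace` — FORM A ⇒ the BODY of K1, through input (A) `queueGridFaceProjection` (qg1 g0, p617795),
  `queueGridPPHard_of_corGridBound` (p615220) with the bridge `corPolytopeGraph_eq` (p615913), and `newtXC_of_inputs` (p615400).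
No Yannakakis port: the rectangle-cover bridge is inside the PROVED `corPolytope_xc_ge` (p616262) that (D3) transports.

Honesty: implications only; K1 stays «closed modulo the print fact» until `GridCorCliqueFace_holds` lands (G♭ construction,
val-lit-p10 g2 / qg1 g0); `AboulkerEtAl2019_corGridMinor_holds` then also follows (p9's `_iff_grid`); HD-1 26253 held;
`NNDivisionHard` 21181 untouched; stmt-23918 / 24468 CLOSED, untouched; VP ≠ VNP is not moved.
-/

-- Sub = Summit single-conjunct layout: the duplicated namespace component is mandated by the tree.
set_option linter.dupNamespace false

namespace Summit.ValiantsHypothesis.ValiantsHypothesis.Theorems.FifoMatching.QueueGridFace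

open Literature.Barriers.PneNP Literature.Computability.MetaComplexity Literature.Combinatorics.Optimization Matrix

/-- **Discharge end: `GridCorCliqueFace` (FORM A, body as hypothesis) ⇒ the grid-only COR bound `hB`** (constant `c/2`,
threshold `max t₀ ⌈4/c⌉₊`): restrict an EF of `COR(G_{t,t})` to the face (`inter_eqs`), push it through `π`
(`image_linearMap`) onto `COR(K_h)`, apply `xc(COR(K_h)) ≥ 2^{h/2}` (`corPolytopeGraph_top_two_pow_half_le`, `h ≥ 4`), and
`(c/2)·t ≤ h/2`. [assembly; cite: AboulkerEtAl2019, proof of Thm 6 (p. 5–6); KaibelWeltge2014, Thm 1] -/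
theorem corGridBound_of_gridCorCliqueFace
    (hG : ∃ c : ℝ, 0 < c ∧ ∃ t₀ : ℕ, ∀ t : ℕ, t₀ ≤ t → ∃ h : ℕ, c * t ≤ h ∧
      ∃ (k : ℕ) (cv : Fin k → (Fin (t * t) × Fin (t * t) → ℝ)) (δ : Fin k → ℝ)
        (π : (Fin (t * t) × Fin (t * t) → ℝ) →ₗ[ℝ] (Fin h × Fin h → ℝ)),
        (∀ i, ∀ x ∈ Literature.Combinatorics.Optimization.corPolytopeGraph
          (Literature.Computability.MetaComplexity.gridGraph t), cv i ⬝ᵥ x ≤ δ i) ∧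
        π '' (Literature.Combinatorics.Optimization.corPolytopeGraph
          (Literature.Computability.MetaComplexity.gridGraph t) ∩ {x | ∀ i, cv i ⬝ᵥ x = δ i}) =
          Literature.Combinatorics.Optimization.corPolytopeGraph (⊤ : SimpleGraph (Fin h))) :
    ∃ c : ℝ, 0 < c ∧ ∃ t₀ : ℕ, ∀ t : ℕ, t₀ ≤ t → ∀ R : ℕ,
      HasEFOfSize (Literature.Combinatorics.Optimization.corPolytopeGraph (gridGraph t)) R → (2 : ℝ) ^ (c * t) ≤ R := by
  classical
  obtain ⟨c, hc, t₀, H⟩ := hG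
  refine ⟨c / 2, by positivity, max t₀ (⌈4 / c⌉₊), fun t ht R hR => ?_⟩
  have ht₀ : t₀ ≤ t := le_trans (le_max_left _ _) ht
  have ht₁ : ⌈4 / c⌉₊ ≤ t := le_trans (le_max_right _ _) ht
  obtain ⟨h, hct, k, cv, δ, π, -, hface⟩ := H t ht₀
  -- `h ≥ 4`
  have h4c : (4 : ℝ) ≤ c * t := by
    have h1 : 4 / c ≤ (⌈4 / c⌉₊ : ℝ) := Nat.le_ceil _
    have h2 : (⌈4 / c⌉₊ : ℝ) ≤ t := by exact_mod_cast ht₁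
    have h3 : 4 / c ≤ (t : ℝ) := h1.trans h2
    have := mul_le_mul_of_nonneg_left h3 hc.le
    rwa [mul_div_cancel₀ _ hc.ne'] at this
  have hh4 : 4 ≤ h := by
    have : (4 : ℝ) ≤ h := h4c.trans hct
    exact_mod_cast this
  -- face, then projection: an EF of `COR(K_h)` of the same size
  have hF := (hR.inter_eqs cv δ).image_linearMap π
  rw [hface] at hF
  have hKW := corPolytopeGraph_top_two_pow_half_le hh4 hF
  -- exponents: `(c/2)·t ≤ h/2`
  have hexp : c / 2 * (t : ℝ) ≤ (h : ℝ) / 2 := by linarith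
  calc (2 : ℝ) ^ (c / 2 * (t : ℝ)) ≤ (2 : ℝ) ^ ((h : ℝ) / 2) :=
        Real.rpow_le_rpow_of_exponent_le one_le_two hexp
    _ ≤ R := hKW

/-- **The body of K1 from `GridCorCliqueFace` (FORM A, body as hypothesis)** — route-independent form; the closer proper
is `exact newtXC_of_gridCorCliqueFace GridCorCliqueFace_holds` against the route decl. [assembly] -/
theorem newtXC_of_gridCorCliqueFace
    (hG : ∃ c : ℝ, 0 < c ∧ ∃ t₀ : ℕ, ∀ t : ℕ, t₀ ≤ t → ∃ h : ℕ, c * t ≤ h ∧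
      ∃ (k : ℕ) (cv : Fin k → (Fin (t * t) × Fin (t * t) → ℝ)) (δ : Fin k → ℝ)
        (π : (Fin (t * t) × Fin (t * t) → ℝ) →ₗ[ℝ] (Fin h × Fin h → ℝ)),
        (∀ i, ∀ x ∈ Literature.Combinatorics.Optimization.corPolytopeGraph
          (Literature.Computability.MetaComplexity.gridGraph t), cv i ⬝ᵥ x ≤ δ i) ∧
        π '' (Literature.Combinatorics.Optimization.corPolytopeGraph
          (Literature.Computability.MetaComplexity.gridGraph t) ∩ {x | ∀ i, cv i ⬝ᵥ x = δ i}) =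
          Literature.Combinatorics.Optimization.corPolytopeGraph (⊤ : SimpleGraph (Fin h))) :
    ∀ c : ℕ, ∃ n₀ : ℕ, ∀ n ≥ n₀, ∀ r : ℕ,
      HasEFOfSize (newt (Literature.Computability.AlgebraicComplexity.nestFreeMatchingPoly n NNReal)) r →
        2 ^ ((Nat.log 2 n + c) ^ c) < r := by
  obtain ⟨c, hc, t₀, H⟩ := corGridBound_of_gridCorCliqueFace hG
  refine newtXC_of_inputs NFPolytopeQuasiPolyXC.QueueGridFace.queueGridFaceProjection
    (queueGridPPHard_of_corGridBound ⟨c, hc, Filter.eventually_atTop.2 ⟨t₀, fun t ht R hR => H t ht R ?_⟩⟩)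
  rwa [corPolytopeGraph_eq]

end Summit.ValiantsHypothesis.ValiantsHypothesis.Theorems.FifoMatching.QueueGridFace
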